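import Literature.RingTheory.Henselian.AugmentedLocalAlgebraBaseChange
import Literature.AlgebraicGeometry.GroupSchemes.UnitComponentReductionKernel
import Literature.AlgebraicGeometry.GroupSchemes.ConnectedFactorsThroughUnitComponent
import Literature.AlgebraicGeometry.GroupSchemes.AffineGroupSchemeHopfAlgebra
import Literature.AlgebraicGeometry.GroupSchemes.BarsottiTateGroupBaseChange
import Mathlib.AlgebraicGeometry.Morphisms.Finite
import HarnessLib

/-!
# The unit component of a finite group scheme over a henselian local ring is stable under LOCAL base change ([Tate1997FiniteFlatGroupSchemes] (3.7))

Topic `Literature/AlgebraicGeometry/GroupSchemes`; namespace `Literature.AlgebraicGeometry.GroupSchemes`.  THEOREMS ONLY (no definition, no named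
fact, no instance, no notation, no `sorry`).  Cell `hodgecm-mathlib` (D-0151 ∕ D-0183 FLOOR 0), P6 «MOD programme», sub-line P6b
`Cruxes/HLiu418/Lines/F0_P6b_ConnectedEtale.lean`, organ **(b1g) «UNIT COMPONENT BASE CHANGE»** (desk F0P6b-plan (g0) 13:58:07Z (C): «for a local map
of henselian local rings `f : R → R′` and `IsUnitComponent G G₀ j` over `Spec R` with `G` finite, the base change `(Over.pullback (Spec.map (ofHom f))).map j`
is a unit component of `(Over.pullback …).obj G` over `Spec R′`» — DICT's bridge `(G_κ̄)⁰ = (G⁰)_κ̄` to P6d's `ker F` on the special fibre).  The line's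
`IsUnitComponent G G₀ j` := `IsMonHom j ∧ IsOpenImmersion j.left ∧ IsClosedImmersion j.left ∧ ConnectedSpace G₀.left`; its four clauses are stated
here explicitly (no `Lines` import), in the base-change currency of ★ `GroupSchemes/BarsottiTateGroupBaseChange` §0 (`Over.pullback`, transported group
laws `Functor.grpObjObj` under `open scoped Obj`, `of_pullback_map_left`).  `--supports stmt-HodgeConjecture-24832`; COUNT-NEUTRAL: HC_CM is proved only
modulo the printed citations until rung 0 closes.

THE PRINT.  [Tate1997FiniteFlatGroupSchemes] (3.7) (I): over a henselian local ring the unit component `G⁰` of a finite group scheme is the spectrum of the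
LOCAL factor of `Γ(G)` through which the counit factors; it is open and closed, a subgroup, and its formation commutes with local base change
(`G⁰ ×_R R′` is again connected, being `Spec` of a local ring: Lemma 2 of the proof, `k_i = k`); [StacksProject] Tag 04GG.

* §1 **`connectedSpace_pullback_of_section`** — `R` henselian local, `G₀ → Spec R` FINITE with CONNECTED underlying space and a SECTION, `f : R → R′`
  LOCAL into a local ring ⇒ `G₀ ×_{Spec R} Spec R′` is connected.  Route: `G₀ ≅ Spec B₀`, `B₀ = Γ(G₀, 𝒪)` module-finite (★ `AffineGroupScheme.Alg`,
  B-p04) and LOCAL (★ `UnitComponent.isLocalRing_of_connectedSpace`, F0P6-p11), augmented by the section (★ `AffineGroupScheme.ptEquiv`), so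
  `B₀ ⊗_R R′` is local (★ `Henselian.isLocalRing_baseChange_of_augmented'`, this organ's algebra half), `Spec` of it is connected (★
  `connectedSpace_primeSpectrum_of_isLocalRing`) and `≅ G₀ ×_R R′` (Mathlib `pullbackSpecIso`, ★ `isoSpec_hom_comp_SpecMap_algebraMapΓ`).
* §2 **`isUnitComponent_baseChange`** — the four clauses for `(Over.pullback (Spec.map (ofHom f))).map j`: homomorphism (instance), open ∕ closed
  immersion (base change), connected source (§1 at the unit section `η[G₀]`; `G₀` is finite as a closed subscheme of the finite `G`).

Sharpness (docstring of §1's algebra): FALSE for `R → R′` not local (`μ_p` over `ℤ_p` base-changed to `ℚ_p` acquires `p` components) and FALSE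
for a non-henselian local `R` (a connected finite `R`-scheme may split over the henselisation).

## References
* [Tate1997FiniteFlatGroupSchemes] J. Tate, *Finite flat group schemes*, in *Modular Forms and Fermat's Last Theorem* (Springer 1997), (3.7) (I)
  and Lemma 2 of its proof.
* [StacksProject] The Stacks Project, Tag 04GG (finite algebras over henselian local rings).
-/

noncomputable section

-- Mathlib's `Over`/pull-back API is stated across semireducible wrappers (as in the ★ `GroupSchemes/*` files).
set_option backward.isDefEq.respectTransparency false

universe u

open CategoryTheory CategoryTheory.Limits AlgebraicGeometry MonoidalCategory CartesianMonoidalCategory TensorProduct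
open scoped MonObj CategoryTheory.Obj

namespace Literature.AlgebraicGeometry.GroupSchemes

open Literature.AlgebraicGeometry.Motives (specOver SchemeOver algebraMapΓ isoSpec_hom_comp_SpecMap_algebraMapΓ)

/-! ## §1 A finite connected scheme with a section over a henselian local ring stays connected under local base change -/

/-- **Connectedness of `G₀ ×_R R'`**: let `R` be a HENSELIAN local ring, `G₀ → Spec R` FINITE with CONNECTED underlying space and a SECTION
`s : Spec R → G₀`, and `f : R → R'` a LOCAL homomorphism to a local ring.  Then `G₀ ×_{Spec R} Spec R'` has connected underlying space.
Proof: `G₀ ≅ Spec B₀` with `B₀ = Γ(G₀, 𝒪)` module-finite (★ `AffineGroupScheme.Alg.moduleFinite`) and LOCAL (connected + finite over henselian,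
★ `UnitComponent.isLocalRing_of_connectedSpace`); the section is an augmentation `B₀ → R` (★ `AffineGroupScheme.ptEquiv`), so `B₀ ⊗_R R'` is
local (★ `Henselian.isLocalRing_baseChange_of_augmented'`), its spectrum is connected (★ `connectedSpace_primeSpectrum_of_isLocalRing`), and
`G₀ ×_R R' ≅ Spec (B₀ ⊗_R R')` (Mathlib `pullbackSpecIso`).  [Tate1997FiniteFlatGroupSchemes] (3.7): «`G⁰ ×_R R'` is the connected component of
`G ×_R R'`» for local `R → R'`. [cite: Tate1997FiniteFlatGroupSchemes, (3.7)] [cite: StacksProject, Tag 04GG] -/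
theorem connectedSpace_pullback_of_section {R : Type u} [CommRing R] [HenselianLocalRing R] {R' : Type u} [CommRing R'] [IsLocalRing R']
    (f : R →+* R') [IsLocalHom f] (G₀ : Over (Spec (.of R))) [IsFinite G₀.hom] [ConnectedSpace G₀.left]
    (s : Spec (.of R) ⟶ G₀.left) (hs : s ≫ G₀.hom = 𝟙 _) :
    ConnectedSpace ↥(pullback G₀.hom (Spec.map (CommRingCat.ofHom f))) := by
  letI := f.toAlgebra
  haveI : IsLocalHom (algebraMap R R') := ‹IsLocalHom f›
  haveI : IsAffine G₀.left := AffineGroupScheme.isAffine_left_of_isAffineHom G₀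
  -- `B₀ = Γ(G₀, 𝒪)`: module-finite, local, augmented
  haveI : Module.Finite R (AffineGroupScheme.Alg G₀) := AffineGroupScheme.Alg.moduleFinite G₀
  haveI : ConnectedSpace (PrimeSpectrum (AffineGroupScheme.Alg G₀)) := by
    have e := Scheme.homeoOfIso G₀.left.isoSpec
    exact e.surjective.connectedSpace e.continuous
  haveI : IsLocalRing (AffineGroupScheme.Alg G₀) := UnitComponent.isLocalRing_of_connectedSpace R
  let s' : specOver R R ⟶ G₀ := Over.homMk s (by
    change s ≫ G₀.hom = Spec.map (CommRingCat.ofHom (algebraMap R R))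
    rw [hs, Algebra.algebraMap_self, CommRingCat.ofHom_id, Spec.map_id])
  let ε : AffineGroupScheme.Alg G₀ →ₐ[R] R := AffineGroupScheme.ptEquiv G₀ R s'
  -- `B₀ ⊗_R R'` is local, hence `Spec` of it is connected
  haveI : IsLocalRing (AffineGroupScheme.Alg G₀ ⊗[R] R') :=
    Literature.RingTheory.Henselian.isLocalRing_baseChange_of_augmented' (R' := R') ε
  haveI : ConnectedSpace ↥(Spec (.of (AffineGroupScheme.Alg G₀ ⊗[R] R'))) :=
    connectedSpace_primeSpectrum_of_isLocalRing (AffineGroupScheme.Alg G₀ ⊗[R] R')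
  -- `G₀ ×_R R' ≅ Spec (B₀ ⊗_R R')`
  have hG₀ : Spec.map (CommRingCat.ofHom (algebraMap R (AffineGroupScheme.Alg G₀))) ≫ 𝟙 (Spec (.of R)) =
      G₀.left.isoSpec.inv ≫ G₀.hom := by
    rw [Category.comp_id, Iso.eq_inv_comp, AffineGroupScheme.Alg.algebraMap_eq, CommRingCat.ofHom_hom]
    exact isoSpec_hom_comp_SpecMap_algebraMapΓ G₀.hom
  let φ : Spec (.of (AffineGroupScheme.Alg G₀ ⊗[R] R')) ⟶ pullback G₀.hom (Spec.map (CommRingCat.ofHom f)) :=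
    (pullbackSpecIso R (AffineGroupScheme.Alg G₀) R').inv ≫
      pullback.map _ _ _ _ G₀.left.isoSpec.inv (𝟙 _) (𝟙 _) hG₀ (by rw [Category.comp_id, Category.id_comp]; rfl)
  haveI : IsIso φ := by
    dsimp only [φ]
    infer_instance
  have e := Scheme.homeoOfIso (asIso φ)
  exact e.surjective.connectedSpace e.continuous

/-! ## §2 The unit component base-changes along local homomorphisms -/

variable {R : Type u} [CommRing R] [HenselianLocalRing R] {R' : Type u} [CommRing R'] [IsLocalRing R']
  (f : R →+* R') [IsLocalHom f] (G G₀ : Over (Spec (.of R))) [GrpObj G] [GrpObj G₀] (j : G₀ ⟶ G)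

/-- **UNIT COMPONENT BASE CHANGE** ([Tate1997FiniteFlatGroupSchemes] (3.7); P6b `IsUnitComponent`, its four clauses spelled out): let `R` be a
HENSELIAN local ring, `G` a FINITE group scheme over `Spec R` with unit component `j : G₀ ↪ G` — a homomorphism which is an OPEN AND CLOSED
immersion with CONNECTED source — and `f : R → R'` a LOCAL homomorphism to a local ring `R'` (cases of record: `R' = κ(R)`, `R' = κ̄`,
`𝒪_L → 𝒪_Ω`).  Then the base change `j ×_R R' : G₀ ×_R R' ⟶ G ×_R R'` (Mathlib `Over.pullback`, transported group laws `Functor.grpObjObj` —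
the currency of ★ `GroupSchemes/BarsottiTateGroupBaseChange`) is again a unit component: a homomorphism, an open and closed immersion (base
change, ★ `of_pullback_map_left`), with connected source (`connectedSpace_pullback_of_section` at the unit section).  This is the bridge
`(G ×_R R')⁰ = G⁰ ×_R R'` (e.g. `(G_κ̄)⁰ = (G⁰)_κ̄`) between the unit component over the henselian base and the one on the (geometric) special fibre.
[cite: Tate1997FiniteFlatGroupSchemes, (3.7)] [cite: StacksProject, Tag 04GG] -/
theorem isUnitComponent_baseChange [IsFinite G.hom] [IsMonHom j] [IsOpenImmersion j.left] [IsClosedImmersion j.left]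
    [ConnectedSpace G₀.left] :
    IsMonHom ((Over.pullback (Spec.map (CommRingCat.ofHom f))).map j) ∧
      IsOpenImmersion ((Over.pullback (Spec.map (CommRingCat.ofHom f))).map j).left ∧
      IsClosedImmersion ((Over.pullback (Spec.map (CommRingCat.ofHom f))).map j).left ∧
      ConnectedSpace ↥((Over.pullback (Spec.map (CommRingCat.ofHom f))).obj G₀).left := by
  refine ⟨inferInstance, of_pullback_map_left _ (P := @IsOpenImmersion) j inferInstance,
    of_pullback_map_left _ (P := @IsClosedImmersion) j inferInstance, ?_⟩
  -- `G₀` is finite over `R` (closed immersion followed by finite) with the unit section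
  haveI : IsFinite G₀.hom := by rw [← Over.w j]; infer_instance
  change ConnectedSpace ↥(pullback G₀.hom (Spec.map (CommRingCat.ofHom f)))
  exact connectedSpace_pullback_of_section f G₀ η[G₀].left (Over.w η[G₀])

end Literature.AlgebraicGeometry.GroupSchemes

end
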